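import Literature.AlgebraicGeometry.Frobenioids.PerfectionFunctoriality
import Literature.AlgebraicGeometry.Frobenioids.PerfectionProofs
import Literature.AlgebraicGeometry.Frobenioids.DivisorMonoidCategoryTheoreticityCorProofsV
import HarnessLib

/-!
# Frobenioids I, Corollary 4.11 (ii) — the reduction "by passing to perfections": the base square
# descends along `C_i → C_i^pf`

Mochizuki, *The geometry of Frobenioids I: the general theory*, Kyushu J. Math. **62** (2008)
293–400; the perfection square of Thm. 3.4 (iii) p. 62 ("a 1-unique functor `Ψ^pf : C₁^pf → C₂^pf` …
1-commutative diagram") and its use "by passing to perfections" in the proofs of Thm. 4.2 (p. 78 l. 41)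
and Thm. 4.9 (p. 89 l. 39), on which the proof of Cor. 4.11 (ii) rests (p. 93 "[cf. Theorem 4.2, (ii)]")
[cite: MochizukiFrdI2008, Thm. 3.4 (iii) p.62]; "by composing diagrams" (proof of Cor. 4.11 (ii), p. 94 l. 6).

PROOF-ONLY file (seat abc-iut-L1-d6, cell sub-DAG S2 `plan/L1/SUBDAG-FrdI-Cor411.md`, the companion of row L00
for the perfections). For THE perfections `C_i^pf` of the tree (`PreFrobenioid.Perfection`, operations
`Perfection.ops` over the SAME base `D_i`, seat abc-iut-L1-d9 lineage; functoriality `Perfection.map`,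
`toPfCompMapIso`, seat abc-iut-L1-d1 lineage):
* `C → C^pf` lies over `D` on the nose (`Perfection.toPfCompBaseIso`, seat abc-iut-L1-d9 lineage:
  `Base(A, 1) = Base(A)`, `baseMap_toPf`);
* `exists_base_equivalence_of_pf` / `cor411ii_of_pf` — a base square for `Ψ^pf` (over the base functors of the
  `C_i^pf`) is a base square for `Ψ`; hence the typed Cor. 4.11 (ii) for `Ψ` (`1`-uniqueness and rigidity for
  Frobenioids: `cor411ii_of_exists_base_equivalence'`).
So the typed Cor. 4.11 (ii) for arbitrary Frobenioids of standard type reduces to its instance for the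
perfections (of the isotropic parts), which are of perfect type — the setting of `Cor411iiBiratApexSetting`.
No new definitions; nothing of the paper is restated; nothing here is specific to the abc programme.
-/

namespace Literature.AlgebraicGeometry.Frobenioids

open CategoryTheory Opposite

universe w v v' u u'

namespace PreFrobenioid

section Two

variable {D₁ : Type u} [Category.{v} D₁] {Φ₁ : D₁ᵒᵖ ⥤ CommMonCat.{w}}
  {C₁ : Type u'} [Category.{v'} C₁] {F₁ : C₁ ⥤ ElemFrobenioid Φ₁}
  {D₂ : Type u} [Category.{v} D₂] {Φ₂ : D₂ᵒᵖ ⥤ CommMonCat.{w}}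
  {C₂ : Type u'} [Category.{v'} C₂] {F₂ : C₂ ⥤ ElemFrobenioid Φ₂}

/-- **"By passing to perfections"**: let `Ψ : C₁ ⥲ C₂` carry arrows of Frobenius type to arrows of
Frobenius type of the same degree (Thm. 3.4 (iii); `IsFrobeniusCompatible`), so that `Ψ^pf : C₁^pf → C₂^pf`
with `toPf₁ ⋙ Ψ^pf ≅ Ψ ⋙ toPf₂` is defined (`Perfection.map`, `toPfCompMapIso`). A base square for `Ψ^pf`
(an equivalence `Ψ^Base` with `Base₂^pf ∘ Ψ^pf ≅ Ψ^Base ∘ Base₁^pf`) is a base square for `Ψ` ("by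
composing diagrams", p. 94). [cite: MochizukiFrdI2008, Thm. 3.4 (iii) p.62] -/
theorem exists_base_equivalence_of_pf (hF₁ : IsFrobenioid F₁) (hF₂ : IsFrobenioid F₂) (Ψ : C₁ ≌ C₂)
    (hΨ : IsFrobeniusCompatible F₁ F₂ Ψ.functor)
    (hex : ∃ ΨBase : D₁ ⥤ D₂, ΨBase.IsEquivalence ∧
      OneCommutes (Perfection.map (hF₁ := hF₁) (hF₂ := hF₂) hΨ) (Perfection.ops hF₂).base
        (Perfection.ops hF₁).base ΨBase) :
    ∃ ΨBase : D₁ ⥤ D₂, ΨBase.IsEquivalence ∧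
      OneCommutes Ψ.functor (PreFrobenioidData.ofFunctor Φ₂ F₂).base (PreFrobenioidData.ofFunctor Φ₁ F₁).base
        ΨBase := by
  obtain ⟨ΨBase, hEq, ⟨σ⟩⟩ := hex
  let ι₁ := Perfection.toPfCompBaseIso (hF := hF₁)
  let ι₂ := Perfection.toPfCompBaseIso (hF := hF₂)
  let τ := Perfection.toPfCompMapIso (hF₁ := hF₁) (hF₂ := hF₂) hΨ
  exact ⟨ΨBase, hEq, ⟨Functor.isoWhiskerLeft Ψ.functor ι₂.symm ≪≫ (Functor.associator _ _ _).symm ≪≫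
    Functor.isoWhiskerRight τ.symm _ ≪≫ Functor.associator _ _ _ ≪≫
      Functor.isoWhiskerLeft (Perfection.toPf hF₁) σ ≪≫ (Functor.associator _ _ _).symm ≪≫
        Functor.isoWhiskerRight ι₁ ΨBase⟩⟩

/-- **Corollary 4.11 (ii) for `Ψ` from the base square for `Ψ^pf`** (FrdI p. 94 ll. 6–8 "by composing
diagrams … easily verified to be 1-unique … the rigidity assertion … follows from Proposition 1.13, (i)"):
under the hypotheses of `exists_base_equivalence_of_pf`, the typed Cor. 4.11 (ii) holds for `Ψ`.
[cite: MochizukiFrdI2008, Cor. 4.11 (ii) p.91] -/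
theorem cor411ii_of_pf (hF₁ : IsFrobenioid F₁) (hF₂ : IsFrobenioid F₂) (Ψ : C₁ ≌ C₂)
    (hΨ : IsFrobeniusCompatible F₁ F₂ Ψ.functor)
    (hex : ∃ ΨBase : D₁ ⥤ D₂, ΨBase.IsEquivalence ∧
      OneCommutes (Perfection.map (hF₁ := hF₁) (hF₂ := hF₂) hΨ) (Perfection.ops hF₂).base
        (Perfection.ops hF₁).base ΨBase) :
    (PreFrobenioidData.ofFunctor Φ₁ F₁).Cor411ii (PreFrobenioidData.ofFunctor Φ₂ F₂) Ψ :=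
  cor411ii_of_exists_base_equivalence' F₁ F₂ Ψ hF₁ hF₂ (exists_base_equivalence_of_pf hF₁ hF₂ Ψ hΨ hex)

end Two

end PreFrobenioid

end Literature.AlgebraicGeometry.Frobenioids
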